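import Summits.BirchSwinnertonDyer.BirchSwinnertonDyer.Theorems.SignedLowerHalvesSmallImageLowerHalfBothSignsRttD2SeqSemilocLevelOps
import Literature.Algebra.Module.LocallyNilpotentPowerSeriesModule
import HarnessLib

/-!
# Route `SignedLowerHalves`, crux L `SmallImageLowerHalfBothSigns` (stmt-BirchSwinnertonDyer-23599), line `rtt_w3` v24 — stub S3β (`stub_junctionPT_ns`), brick T1-b₂:
# THE SEMILOCAL IWASAWA MODULE AT A DEPLETED PLACE — `𝐇^i_{Iw,w} := lim←_{n,k} H^i(Γ_{K_w}, Maps(Γ_K ⧸ U_n, X_k))` AS A PINNED `Λ_𝒪`-MODULE DATUM (`SemilocIwasawaCohomologyDataO`), CONSTRUCTED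

WIDTH seat `bsd-line-slh-p3-w3` g25 under LEAD `cruxlead-stmt-BirchSwinnertonDyer-23599` g13 (cell `bsd-ssimc`); helper `--supports stmt-BirchSwinnertonDyer-23599`
(design memo `Lines/rtt_w3-DESIGN-S3beta-w3-g25.md`, §2 T1-b). DEFINITIONS WITH BODIES (a structure, three `Module` structures, the constructed datum) + THEOREMS; no named fact, no
instance, no `sorry`. The SEMILOCAL TWIN of honda's `…RttD2J1CyclotomicCarrier` (`CycIwasawaCohomologyDataO`, p782087): same pins (P1)–(P8), same construction (compatible
families in the product, `Λ_𝒪` through `LocallyNilpotent.exists_module_powerSeries` on `ψ_γ = R_γ − 1`, locally nilpotent because `R_γ^{pⁿ} = id` on level `n` and the level is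
killed by `p^k`), for the semilocal layer groups of T1-a/T1-b₁. This is the object `Hloc_w` of the compact five-term sequence behind S3β (`B′ ↪ I.H → ⊕_{w∈S₀K} Hloc_w → coker gX ↠ Y′`).
HONEST FRAMING: an existence/packaging result; nothing about S3β, E2, crux L or BSD is proved; all remain OPEN and are proved for NO curve.

* §1 `semilocPsi` (`ψ_γ = R_γ − 1`, `𝒪`-linear, locally nilpotent), ★ `semilocLayerModuleΛ` (the forced `Λ_𝒪 = 𝒪⟦T⟧`-structure of a level: `C a ↦ a ⊗ id`, `T ↦ ψ_γ`),
  `semilocCores_smulΛ`/`semilocRed_smulΛ` (the transitions are `Λ_𝒪`-linear).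
* §2 `structure SemilocIwasawaCohomologyDataO S κ γ θ′ P w i` (H, proj, P1–P8) and its `Λ`-structure by restriction of scalars (`moduleIwasawa`, `isScalarTower_moduleIwasawa`, `proj_T_smul`).
* §3 ★★ `semilocIwasawaCohomologyDataO` (CONSTRUCTED) and `nonempty_semilocIwasawaCohomologyDataO` — for every `K`, `p`, `S`, `κ`, `γ`, `θ′`, `P`, `w`, `i`.
References: [Kato2004Asterisque] §8.2, §12.2, §17.13; [NeukirchSchmidtWingberg2008] (8.6.2)–(8.6.3); [Rubin2000] App. B.3; [Lang1990] Ch. 5 §1; [Kaplansky1954] §19.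
-/

set_option autoImplicit false
set_option linter.dupNamespace false -- D-0017: single-problem summit, the namespace repeats the problem name by design
noncomputable section

open scoped Classical PowerSeries
open NumberField IsDedekindDomain Field CategoryTheory Function

namespace Summit.BirchSwinnertonDyer.BirchSwinnertonDyer.Theorems.SmallImageRttD2Seq

open Literature.NumberTheory.EllipticCurves Literature.NumberTheory.EllipticCurves.IwasawaDual Literature.NumberTheory.GaloisRepresentations
  Literature.NumberTheory.ComplexMultiplication.EllipticUnits.JohnsonLeungKings2011
  Literature.Algebra.Module.LocallyNilpotent
  Summit.BirchSwinnertonDyer.BirchSwinnertonDyer.Theorems.SmallImageRttD2J1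

/-! ## §1. The forced `Λ_𝒪`-structure of a semilocal level -/

section LayerOps

variable {K : Type} [Field K] [NumberField K] {p : ℕ} [Fact p.Prime] (S : Set (PadicAlgCl p)) (κ : ZpExtension K p) (γ : absoluteGaloisGroup K)
  (θ' : absoluteGaloisGroup K →ₜ* (padicCoeffIntegers S)ˣ) (P : Set (HeightOneSpectrum (𝓞 K))) (w : HeightOneSpectrum (𝓞 K))

/-- **`R_γ − 1` is locally nilpotent on every semilocal level** (`p^k`-torsion + `R_γ^{pⁿ} = 1`; the tree's `exists_pow_twistEnd_sub_one_apply_eq_zero` at the trivial twist). [cite: Lang1990, Ch. 5 §1] -/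
theorem exists_pow_semilocConjEnd_sub_one_apply_eq_zero (n k i : ℕ) (x : semilocCoh S κ θ' P w n k i) :
    ∃ M : ℕ, ((semilocConjEnd S κ θ' P w n k i γ - 1) ^ M) x = 0 := by
  have h := exists_pow_twistEnd_sub_one_apply_eq_zero (p := p) (n := 1) (e := k) (m := n) (semilocConjEnd S κ θ' P w n k i γ)
    (fun a ↦ semilocConjEnd_pow_index_apply S κ θ' P w n k i γ a) (fun a ↦ semilocCoh_torsion S κ θ' P w n k i a)
    (by rw [Nat.cast_one, sub_self]; exact dvd_zero _) x
  rwa [twistEnd_one] at h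

/-- **The `𝒪`-LINEAR operator `ψ_γ = R_γ − 1` on the semilocal level `(n, k)`.** [cite: JohnsonLeungKings2011, §4.2] [cite: SerreLocalFields1979, VII §5] -/
def semilocPsi (n k i : ℕ) (γ : absoluteGaloisGroup K) :
    letI := semilocModuleO S κ θ' P w n k i
    Module.End (padicCoeffIntegers S) (semilocCoh S κ θ' P w n k i) := by
  letI := semilocModuleO S κ θ' P w n k i
  exact
    { toFun := fun c ↦ semilocConj S κ θ' P w n k i γ c - c
      map_add' := fun x y ↦ by rw [map_add]; abel
      map_smul' := fun c x ↦ by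
        change semilocConj S κ θ' P w n k i γ (semilocScalar S κ θ' P w n k i c x) - semilocScalar S κ θ' P w n k i c x =
          semilocScalar S κ θ' P w n k i c (semilocConj S κ θ' P w n k i γ x - x)
        rw [map_sub, semilocScalar_semilocConj] }

/-- Unfolding `semilocPsi`: `ψ_γ c = R_γ c − c`. [folklore] -/
theorem semilocPsi_apply (n k i : ℕ) (γ : absoluteGaloisGroup K) (c : semilocCoh S κ θ' P w n k i) :
    (letI := semilocModuleO S κ θ' P w n k i
     semilocPsi S κ θ' P w n k i γ c) = semilocConj S κ θ' P w n k i γ c - c := rfl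

/-- Powers of `ψ_γ` agree with powers of `R_γ − 1` in `AddMonoid.End`. [folklore] -/
theorem semilocPsi_pow_apply (n k i : ℕ) (γ : absoluteGaloisGroup K) (m : ℕ) (c : semilocCoh S κ θ' P w n k i) :
    (letI := semilocModuleO S κ θ' P w n k i
     (semilocPsi S κ θ' P w n k i γ ^ m) c) = ((semilocConjEnd S κ θ' P w n k i γ - 1) ^ m) c := by
  letI := semilocModuleO S κ θ' P w n k i
  induction m generalizing c with
  | zero => rfl
  | succ m ih =>
    rw [pow_succ, pow_succ, Module.End.mul_apply, AddMonoid.End.coe_mul, Function.comp_apply, semilocPsi_apply, ih]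
    rfl

/-- `ψ_γ` is locally nilpotent (the hypothesis of `LocallyNilpotent.exists_module_powerSeries`). [cite: Lang1990, Ch. 5 §1] -/
theorem semilocPsi_locallyNilpotent (n k i : ℕ) (c : semilocCoh S κ θ' P w n k i) :
    letI := semilocModuleO S κ θ' P w n k i
    ∃ m : ℕ, (semilocPsi S κ θ' P w n k i γ ^ m) c = 0 := by
  obtain ⟨m, hm⟩ := exists_pow_semilocConjEnd_sub_one_apply_eq_zero S κ γ θ' P w n k i c
  exact ⟨m, by rw [semilocPsi_pow_apply, hm]⟩

/-- **Existence of the `Λ_𝒪 = 𝒪⟦T⟧`-structure on a semilocal level**: `X ↦ ψ_γ`, constants `C a ↦ a ⊗ id` (Kaplansky §19 (a) for the locally nilpotent `ψ_γ`). [cite: Kaplansky1954, §19] [cite: Lang1990, Ch. 5 §1] -/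
theorem exists_semilocLayerModuleΛ (n k i : ℕ) :
    letI := semilocModuleO S κ θ' P w n k i
    ∃ (_ : Module (IwasawaAlgebraO S) (semilocCoh S κ θ' P w n k i)),
      (∀ (a : padicCoeffIntegers S) (v : semilocCoh S κ θ' P w n k i), (PowerSeries.C a : IwasawaAlgebraO S) • v = a • v) ∧
        ∀ v : semilocCoh S κ θ' P w n k i, (PowerSeries.X : IwasawaAlgebraO S) • v = semilocPsi S κ θ' P w n k i γ v := by
  letI := semilocModuleO S κ θ' P w n k i
  exact exists_module_powerSeries (semilocPsi S κ θ' P w n k i γ) (semilocPsi_locallyNilpotent S κ γ θ' P w n k i)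

/-- ★ **The `Λ_𝒪`-structure of the semilocal level `(n, k)`** (a choice from `exists_semilocLayerModuleΛ`, whose ACTION is forced; activate with `letI`). [cite: Lang1990, Ch. 5 §1] -/
@[reducible] def semilocLayerModuleΛ (n k i : ℕ) : Module (IwasawaAlgebraO S) (semilocCoh S κ θ' P w n k i) :=
  (exists_semilocLayerModuleΛ S κ γ θ' P w n k i).choose

/-- The defining identities: `C a ↦ a ⊗ id`, `T ↦ ψ_γ`. [cite: Lang1990, Ch. 5 §1] -/
theorem semilocLayerModuleΛ_spec (n k i : ℕ) :
    letI := semilocModuleO S κ θ' P w n k i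
    letI := semilocLayerModuleΛ S κ γ θ' P w n k i
    (∀ (a : padicCoeffIntegers S) (v : semilocCoh S κ θ' P w n k i), (PowerSeries.C a : IwasawaAlgebraO S) • v = a • v) ∧
      ∀ v : semilocCoh S κ θ' P w n k i, (PowerSeries.X : IwasawaAlgebraO S) • v = semilocPsi S κ θ' P w n k i γ v :=
  (exists_semilocLayerModuleΛ S κ γ θ' P w n k i).choose_spec

/-- **The corestrictions are `Λ_𝒪`-linear** (`𝒪`-linear and intertwine `ψ_γ`; Kaplansky §19 (a)). [cite: Kaplansky1954, §19] [cite: NeukirchSchmidtWingberg2008, I §5 Prop. 1.5.4] -/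
theorem semilocCores_smulΛ (n k i : ℕ) (F : IwasawaAlgebraO S) (y : semilocCoh S κ θ' P w (n + 1) k i) :
    semilocCores S κ θ' P w n k i (letI := semilocLayerModuleΛ S κ γ θ' P w (n + 1) k i; F • y) =
      (letI := semilocLayerModuleΛ S κ γ θ' P w n k i; F • semilocCores S κ θ' P w n k i y) := by
  letI i0 := semilocModuleO S κ θ' P w (n + 1) k i
  letI i2 := semilocLayerModuleΛ S κ γ θ' P w (n + 1) k i
  letI j0 := semilocModuleO S κ θ' P w n k i
  letI j2 := semilocLayerModuleΛ S κ γ θ' P w n k i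
  obtain ⟨hC, hX⟩ := semilocLayerModuleΛ_spec S κ γ θ' P w (n + 1) k i
  obtain ⟨hC', hX'⟩ := semilocLayerModuleΛ_spec S κ γ θ' P w n k i
  let f : semilocCoh S κ θ' P w (n + 1) k i →ₗ[padicCoeffIntegers S] semilocCoh S κ θ' P w n k i :=
    { toFun := semilocCores S κ θ' P w n k i
      map_add' := map_add _
      map_smul' := fun c y ↦ semilocCores_semilocScalar S κ θ' P w n k i c y }
  exact map_smul_of_comp_eq hC hX hC' hX' (semilocPsi_locallyNilpotent S κ γ θ' P w (n + 1) k i) f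
    (fun y ↦ by
      change semilocCores S κ θ' P w n k i (semilocConj S κ θ' P w (n + 1) k i γ y - y) =
        semilocConj S κ θ' P w n k i γ (semilocCores S κ θ' P w n k i y) - semilocCores S κ θ' P w n k i y
      rw [map_sub, semilocCores_semilocConj]) F y

/-- **The reductions are `Λ_𝒪`-linear.** [cite: Kaplansky1954, §19] [cite: Kato2004Asterisque, §8.2 (p. 180)] -/
theorem semilocRed_smulΛ (n k i : ℕ) (F : IwasawaAlgebraO S) (y : semilocCoh S κ θ' P w n (k + 1) i) :
    semilocRed S κ θ' P w n k i (letI := semilocLayerModuleΛ S κ γ θ' P w n (k + 1) i; F • y) =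
      (letI := semilocLayerModuleΛ S κ γ θ' P w n k i; F • semilocRed S κ θ' P w n k i y) := by
  letI i0 := semilocModuleO S κ θ' P w n (k + 1) i
  letI i2 := semilocLayerModuleΛ S κ γ θ' P w n (k + 1) i
  letI j0 := semilocModuleO S κ θ' P w n k i
  letI j2 := semilocLayerModuleΛ S κ γ θ' P w n k i
  obtain ⟨hC, hX⟩ := semilocLayerModuleΛ_spec S κ γ θ' P w n (k + 1) i
  obtain ⟨hC', hX'⟩ := semilocLayerModuleΛ_spec S κ γ θ' P w n k i
  let f : semilocCoh S κ θ' P w n (k + 1) i →ₗ[padicCoeffIntegers S] semilocCoh S κ θ' P w n k i :=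
    { toFun := semilocRed S κ θ' P w n k i
      map_add' := map_add _
      map_smul' := fun c y ↦ semilocRed_semilocScalar S κ θ' P w n k i c y }
  exact map_smul_of_comp_eq hC hX hC' hX' (semilocPsi_locallyNilpotent S κ γ θ' P w n (k + 1) i) f
    (fun y ↦ by
      change semilocRed S κ θ' P w n k i (semilocConj S κ θ' P w n (k + 1) i γ y - y) =
        semilocConj S κ θ' P w n k i γ (semilocRed S κ θ' P w n k i y) - semilocRed S κ θ' P w n k i y
      rw [map_sub, semilocRed_semilocConj]) F y

end LayerOps

/-! ## §2. The pinned datum -/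

section Data

variable {K : Type} [Field K] [NumberField K] {p : ℕ} [Fact p.Prime] (S : Set (PadicAlgCl p)) (κ : ZpExtension K p) (γ : absoluteGaloisGroup K)
  (θ' : absoluteGaloisGroup K →ₜ* (padicCoeffIntegers S)ˣ) (P : Set (HeightOneSpectrum (𝓞 K))) (w : HeightOneSpectrum (𝓞 K))

/-- ★ **PINNED `Λ_𝒪`-MODULE DATA FOR THE SEMILOCAL IWASAWA COHOMOLOGY `𝐇^i_{Iw,w} = lim←_{n,k} H^i(Γ_{K_w}, Maps(Γ_K ⧸ U_n, X_k))` at a finite place `w`** (`= ⊕_{w′∣w} 𝐇^i_{Iw}(K_{w′}, T*)`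
by Mackey–Shapiro) — the semilocal twin of honda's `CycIwasawaCohomologyDataO`: an abstract `Λ_𝒪`-module `H` with additive projections to the semilocal levels; (P1)–(P2) compatibility with
corestriction (= fibre sum) and reduction; (P3)/(P4) joint injectivity / surjectivity onto compatible families; (P5) `T` acts as `R_γ − 1` (right translation by the generator); (P7) constants
act by `c ⊗ id`; (P8) each `ker (proj n k)` is a submodule. Existence = §3. [cite: Kato2004Asterisque, §8.2 (p. 180), §17.13] [cite: NeukirchSchmidtWingberg2008, (8.6.2)–(8.6.3)] [cite: Rubin2000, App. B.3] -/
structure SemilocIwasawaCohomologyDataO (i : ℕ) : Type 1 where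
  /-- The underlying type of `𝐇^i_{Iw,w}`. -/
  H : Type
  /-- `𝐇^i_{Iw,w}` is an abelian group. -/
  [addCommGroup : AddCommGroup H]
  /-- `𝐇^i_{Iw,w}` is a `Λ_𝒪 = 𝒪⟦T⟧`-module. -/
  [module : Module (IwasawaAlgebraO S) H]
  /-- The projection to the level `(n, k)`. -/
  proj : ∀ n k : ℕ, H →+ semilocCoh S κ θ' P w n k i
  /-- (P1) compatibility with the corestrictions. -/
  proj_cores : ∀ (n k : ℕ) (x : H), semilocCores S κ θ' P w n k i (proj (n + 1) k x) = proj n k x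
  /-- (P2) compatibility with the reductions. -/
  proj_red : ∀ (n k : ℕ) (x : H), semilocRed S κ θ' P w n k i (proj n (k + 1) x) = proj n k x
  /-- (P3) the projections are jointly injective. -/
  proj_injective : ∀ x : H, (∀ n k, proj n k x = 0) → x = 0
  /-- (P4) every compatible family comes from `H`. -/
  proj_surjective : ∀ y : (∀ n k : ℕ, semilocCoh S κ θ' P w n k i),
    (∀ n k, semilocCores S κ θ' P w n k i (y (n + 1) k) = y n k) → (∀ n k, semilocRed S κ θ' P w n k i (y n (k + 1)) = y n k) →
      ∃ x : H, ∀ n k, proj n k x = y n k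
  /-- (P5) `T` acts as `R_γ − 1`. -/
  proj_X_smul : ∀ (n k : ℕ) (x : H),
    proj n k ((PowerSeries.X : IwasawaAlgebraO S) • x) = semilocConj S κ θ' P w n k i γ (proj n k x) - proj n k x
  /-- (P7) constants `c ∈ 𝒪` act by `c ⊗ id`. -/
  proj_C_smul : ∀ (c : padicCoeffIntegers S) (n k : ℕ) (x : H),
    proj n k ((PowerSeries.C c : IwasawaAlgebraO S) • x) = semilocScalar S κ θ' P w n k i c (proj n k x)
  /-- (P8) (continuity) each `ker (proj n k)` is a `Λ_𝒪`-submodule. -/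
  proj_smul_eq_zero : ∀ (n k : ℕ) (f : IwasawaAlgebraO S) (x : H), proj n k x = 0 → proj n k (f • x) = 0

attribute [instance] SemilocIwasawaCohomologyDataO.addCommGroup SemilocIwasawaCohomologyDataO.module

namespace SemilocIwasawaCohomologyDataO

variable {S κ γ θ' P w} {i : ℕ} (L : SemilocIwasawaCohomologyDataO S κ γ θ' P w i)

/-- **The scalar-tower `Λ = ℤ_p⟦T⟧`-structure** on `𝐇^i_{Iw,w}` (restriction of scalars along `iwasawaToIwasawaO S`; activate with `letI`). [cite: JohnsonLeungKings2011, §4.1 Def. 4.1] -/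
@[reducible] def moduleIwasawa : Module (IwasawaAlgebra p) L.H :=
  Module.compHom L.H (iwasawaToIwasawaO S)

/-- The `Λ`-action is `g • x = (iwasawaToIwasawaO S g) • x`. [folklore] -/
theorem moduleIwasawa_smul (g : IwasawaAlgebra p) (x : L.H) : (letI := L.moduleIwasawa; g • x) = iwasawaToIwasawaO S g • x := rfl

/-- `IsScalarTower Λ Λ_𝒪 𝐇^i_{Iw,w}` for the algebra structure `iwasawaToIwasawaO S`. [cite: JohnsonLeungKings2011, §4.1 Def. 4.1] -/
theorem isScalarTower_moduleIwasawa :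
    letI := L.moduleIwasawa
    letI := (iwasawaToIwasawaO S).toAlgebra
    IsScalarTower (IwasawaAlgebra p) (IwasawaAlgebraO S) L.H := by
  letI := L.moduleIwasawa
  letI := (iwasawaToIwasawaO S).toAlgebra
  exact ⟨fun g f x ↦ by
    change (g • f) • x = iwasawaToIwasawaO S g • (f • x)
    rw [Algebra.smul_def, mul_smul]
    rfl⟩

/-- (P5) for the `Λ`-structure: Λ's variable acts as `R_γ − 1`. [cite: JohnsonLeungKings2011, §4.2] -/
theorem proj_T_smul (n k : ℕ) (x : L.H) :
    L.proj n k (letI := L.moduleIwasawa; (PowerSeries.X : IwasawaAlgebra p) • x) = semilocConj S κ θ' P w n k i γ (L.proj n k x) - L.proj n k x := by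
  rw [moduleIwasawa_smul, show iwasawaToIwasawaO S (PowerSeries.X : IwasawaAlgebra p) = PowerSeries.X from PowerSeries.map_X _, L.proj_X_smul]

/-- A compatible family of level classes determines its lift uniquely ((P3)). [folklore] -/
theorem eq_of_forall_proj_eq {x y : L.H} (h : ∀ n k, L.proj n k x = L.proj n k y) : x = y := by
  rw [← sub_eq_zero]
  exact L.proj_injective _ fun n k ↦ by rw [map_sub, h n k, sub_self]

end SemilocIwasawaCohomologyDataO

end Data

/-! ## §3. Construction -/

section Construction

variable {K : Type} [Field K] [NumberField K] {p : ℕ} [Fact p.Prime] (S : Set (PadicAlgCl p)) (κ : ZpExtension K p) (γ : absoluteGaloisGroup K)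
  (θ' : absoluteGaloisGroup K →ₜ* (padicCoeffIntegers S)ˣ) (P : Set (HeightOneSpectrum (𝓞 K))) (w : HeightOneSpectrum (𝓞 K)) (i : ℕ)

/-- The product `Λ_𝒪`-module `∏_{n,k} Lloc_w(n,k)` (activate with `letI`). [cite: Kato2004Asterisque, §8.2 (p. 180)] -/
@[reducible] def piSemilocLayerModuleΛ : Module (IwasawaAlgebraO S) (∀ n k : ℕ, semilocCoh S κ θ' P w n k i) := by
  letI : ∀ n k : ℕ, Module (IwasawaAlgebraO S) (semilocCoh S κ θ' P w n k i) := fun n k ↦ semilocLayerModuleΛ S κ γ θ' P w n k i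
  infer_instance

/-- The product action is componentwise. [folklore] -/
theorem piSemilocLayerModuleΛ_smul_apply (F : IwasawaAlgebraO S) (y : ∀ n k : ℕ, semilocCoh S κ θ' P w n k i) (n k : ℕ) :
    (letI := piSemilocLayerModuleΛ S κ γ θ' P w i; F • y) n k = (letI := semilocLayerModuleΛ S κ γ θ' P w n k i; F • y n k) := rfl

/-- **`𝐇^i_{Iw,w} := lim←_{n,k} Lloc_w(n,k)` as a `Λ_𝒪`-SUBMODULE of the product**: the compatible families (stable because the transitions are `Λ_𝒪`-linear). [cite: Kato2004Asterisque, §8.2 (p. 180)] -/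
def semilocCompatibleFamilies :
    letI := piSemilocLayerModuleΛ S κ γ θ' P w i
    Submodule (IwasawaAlgebraO S) (∀ n k : ℕ, semilocCoh S κ θ' P w n k i) := by
  letI := piSemilocLayerModuleΛ S κ γ θ' P w i
  exact
    { carrier := {y | (∀ n k, semilocCores S κ θ' P w n k i (y (n + 1) k) = y n k) ∧ ∀ n k, semilocRed S κ θ' P w n k i (y n (k + 1)) = y n k}
      zero_mem' := ⟨fun n k ↦ by simp only [Pi.zero_apply, map_zero], fun n k ↦ by simp only [Pi.zero_apply, map_zero]⟩
      add_mem' := fun {y y'} hy hy' ↦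
        ⟨fun n k ↦ by simp only [Pi.add_apply, map_add, hy.1 n k, hy'.1 n k], fun n k ↦ by simp only [Pi.add_apply, map_add, hy.2 n k, hy'.2 n k]⟩
      smul_mem' := fun F y hy ↦
        ⟨fun n k ↦ by rw [piSemilocLayerModuleΛ_smul_apply, piSemilocLayerModuleΛ_smul_apply, semilocCores_smulΛ, hy.1 n k],
          fun n k ↦ by rw [piSemilocLayerModuleΛ_smul_apply, piSemilocLayerModuleΛ_smul_apply, semilocRed_smulΛ, hy.2 n k]⟩ }

/-- ★★ **The pinned datum `𝐇^i_{Iw,w}`, CONSTRUCTED**: carrier = the compatible families, `proj n k` = coordinates; (P1)–(P4) by construction, (P5)/(P7) = the defining identities of the level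
structures, (P8) because the action is levelwise. [cite: Kato2004Asterisque, §8.2 (p. 180), §17.13] [cite: Rubin2000, App. B.3] -/
def semilocIwasawaCohomologyDataO : SemilocIwasawaCohomologyDataO S κ γ θ' P w i :=
  letI := piSemilocLayerModuleΛ S κ γ θ' P w i
  { H := ↥(semilocCompatibleFamilies S κ γ θ' P w i)
    proj := fun n k ↦
      { toFun := fun y ↦ (y : ∀ n k : ℕ, semilocCoh S κ θ' P w n k i) n k
        map_zero' := rfl
        map_add' := fun _ _ ↦ rfl }
    proj_cores := fun n k y ↦ y.2.1 n k
    proj_red := fun n k y ↦ y.2.2 n k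
    proj_injective := fun y hy ↦ Subtype.ext (funext fun n ↦ funext fun k ↦ hy n k)
    proj_surjective := fun y hy hy' ↦ ⟨⟨y, hy, hy'⟩, fun _ _ ↦ rfl⟩
    proj_X_smul := fun n k y ↦ by
      change (letI := semilocLayerModuleΛ S κ γ θ' P w n k i; (PowerSeries.X : IwasawaAlgebraO S) • (y : ∀ n k : ℕ, semilocCoh S κ θ' P w n k i) n k) = _
      rw [(semilocLayerModuleΛ_spec S κ γ θ' P w n k i).2, semilocPsi_apply]
      rfl
    proj_C_smul := fun c n k y ↦ by
      change (letI := semilocLayerModuleΛ S κ γ θ' P w n k i; (PowerSeries.C c : IwasawaAlgebraO S) • (y : ∀ n k : ℕ, semilocCoh S κ θ' P w n k i) n k) = _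
      letI := semilocModuleO S κ θ' P w n k i
      rw [(semilocLayerModuleΛ_spec S κ γ θ' P w n k i).1]
      rfl
    proj_smul_eq_zero := fun n k F y hy ↦ by
      letI := semilocLayerModuleΛ S κ γ θ' P w n k i
      change F • (y : ∀ n k : ℕ, semilocCoh S κ θ' P w n k i) n k = 0
      have hy' : (y : ∀ n k : ℕ, semilocCoh S κ θ' P w n k i) n k = 0 := hy
      rw [hy', smul_zero] }

/-- ★★ **EXISTENCE: `Nonempty (SemilocIwasawaCohomologyDataO S κ γ θ′ P w i)`** for EVERY number field `K`, prime `p`, coefficient set `S`, `ℤ_p`-extension `κ`, `γ ∈ Γ_K`, character `θ′`, set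
of places `P`, finite place `w` and degree `i`: the semilocal module `Hloc_w` of the five-term sequence behind S3β exists as a genuine `Λ_𝒪`-module. [cite: Kato2004Asterisque, §8.2, §17.13] [cite: Rubin2000, App. B.3] -/
theorem nonempty_semilocIwasawaCohomologyDataO : Nonempty (SemilocIwasawaCohomologyDataO S κ γ θ' P w i) :=
  ⟨semilocIwasawaCohomologyDataO S κ γ θ' P w i⟩

end Construction

end Summit.BirchSwinnertonDyer.BirchSwinnertonDyer.Theorems.SmallImageRttD2Seq

end
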